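import Literature.NumberTheory.GaloisRepresentations.LubinTateComparisonPoints
import Literature.NumberTheory.GaloisRepresentations.LubinTateColemanNorm
import HarnessLib

/-!
# The `π`-division points of the Lubin–Tate group read in `𝔪_ℂ ⊂ 𝒪_{ℂ_F}`: an injective
# `𝓀_F`-indexed family, and EVERY `f`-torsion point of `𝔪_ℂ` is one of them

Topic `NumberTheory/GaloisRepresentations`; namespace `Literature.NumberTheory.GaloisRepresentations`.
Cell `bsd-print-cf2` (HOME `run/shared/lean/pub/bsd-print-cf2/`), seat `bsd-line-cf2-p1-w7` g7, planner g20's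
assignment (2026-08-29T11:51:38Z), **GAP-4** of cf2c-w4 g5's `Cruxes/TwoVariableMainConjAtSplitTwoQuad/
ASSEMBLY-GUIDE-measure-side-w4g5.md` §1, sequel of `LubinTateRootsOfUnityTorsion.lean` (the pigeonhole
`exists_rootsOfUnity_enum_of_torsion_transport`, whose inputs are supplied here): for `f = πX + X^q` over
`𝒪_F`, the `q` division points `ω_c = [residueDigit c] λ₁ ∈ 𝔪_{K_π^1}` (`ltDivPt hπ 0 c`, Cassels–Fröhlich VI
§3.6 Prop. 6 (a): `f = ∏_c (X − ω_c)`, tree `map_ltPoly_eq_prod`) transported along the isometry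
`𝒪_{K_π^{n+1}} → 𝒪_{ℂ_F}` (`unitBallToCBall`):

* `unitBallToCBall_injective`, **`injective_ltDivPt_toCBall`** — `c ↦ ω_c ∈ 𝔪_ℂ` is injective (the family `ω`
  of the pigeonhole);
* **`exists_eq_ltDivPt_toCBall_of_aeval_ltPoly_eq_zero`** — every `z ∈ 𝔪_ℂ` with `f(z) = 0` IS some `ω_c`:
  an `f = f^{(1)}`-torsion point of `ℂ_F` is algebraic, in `K_π^1` (tree
  `exists_algClosureToC_eq_of_aeval_eq_zero`), hence a root of `∏_c (X − ω_c)` in the domain `𝒪_{K_π^1}` —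
  with the torsion transport `[π]_{f'} ∘ ϑ = ϑ ∘ [p]_{Ĝ_m}` (p715802) this is the hypothesis `hΘω` of the
  pigeonhole («`(1+z)^p = 1 ⟹ ϑ(z)` is a division point»).

No definition, no named fact, no `sorry`; the `attribute [local instance]` line only re-activates the tree's
normed-field structures `rk1 nF nE` on `F` and on finite subextensions of `F̄` (as in `LubinTateComparisonPoints`),
it declares nothing. HONEST FRAMING: local analytic bookkeeping for brick (d) of the (Q)-socket; BSD is not
advanced by this file.

## References
* [CasselsFrohlichANT1967] J.-P. Serre, *Local class field theory* (Cassels–Fröhlich Ch. VI), §3.6 Prop. 6 (a).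
* [SerreLocalFields1979] J.-P. Serre, *Local Fields*, Ch. II §2 Cor. 3 (uniqueness of the extended absolute
  value: `F̄ → ℂ_F` is isometric on finite subextensions).
-/

noncomputable section

open MvPowerSeries Polynomial

namespace Literature.NumberTheory.GaloisRepresentations

open ValuativeRel IsLocalRing Field IsNonarchimedeanLocalField LubinTate
open Literature.NumberTheory.PAdicHodge

variable {F : Type} [Field F] [ValuativeRel F] [TopologicalSpace F] [IsNonarchimedeanLocalField F]

-- the normed-field instances on `F` and on finite subextensions of `F̄` of `LubinTateTorsion.lean`
attribute [local instance] instUniformSpace_literature rk1 nF nE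

section Injective

variable (E : IntermediateField F (AlgebraicClosure F)) [FiniteDimensional F E]

/-- `𝒪_E → 𝒪_{ℂ_F}` is injective (it is an isometry, `F̄ → ℂ_F` being injective).
[cite: SerreLocalFields1979, Ch. II §2 Cor. 3] -/
theorem unitBallToCBall_injective : Function.Injective (unitBallToCBall (F := F) E) := by
  intro x y h
  have h' := congrArg (fun z : CBall F => (z : CompletedAlgClosure F)) h
  simp only [coe_unitBallToCBall] at h'
  exact Subtype.ext (Subtype.ext ((algClosureToC F).injective h'))

end Injective

section DivisionPoints

variable {π : 𝒪[F]} (hπ : (valuation F).IsUniformizer (π : F))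

/-- **The `𝓀_F`-indexed `π`-division points `ω_c` read in `𝔪_ℂ` form an injective family** (tree
`ltDivPt_injective` + `unitBallToCBall_injective`). [cite: CasselsFrohlichANT1967, Ch. VI §3.6 Prop. 6 (a)] -/
theorem injective_ltDivPt_toCBall (n : ℕ) :
    Function.Injective (fun c : 𝓀[F] =>
      (⟨unitBallToCBall (ltField π n) (ltDivPt hπ n c : unitBall (ltField π n)),
        unitBallToCBall_mem (ltField π n) (ltDivPt hπ n c).2⟩ : (maxNilIdealC F).toIdeal)) := by
  intro c c' h
  have h' := congrArg (fun z : (maxNilIdealC F).toIdeal => (z : CBall F)) h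
  exact ltDivPt_injective hπ n (Subtype.ext (unitBallToCBall_injective (ltField π n) h'))

/-- **Every `f`-torsion point of `𝔪_ℂ` is a division point**: if `z ∈ 𝔪_ℂ` satisfies `f(z) = 0`
(`f = πX + X^q` read in `ℂ_F`), then `z = ω_c` for some `c ∈ 𝓀_F` (`ω_c ∈ 𝒪_{K_π^1}` read in `𝒪_{ℂ_F}`):
`z` is algebraic and lies in `K_π^1` (`exists_algClosureToC_eq_of_aeval_eq_zero`, `f = f^{(1)}`), where
`f = ∏_c (X − ω_c)` (`map_ltPoly_eq_prod`) over the domain `𝒪_{K_π^1}`.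
[cite: CasselsFrohlichANT1967, Ch. VI §3.6 Prop. 6 (a)] -/
theorem exists_eq_ltDivPt_toCBall_of_aeval_ltPoly_eq_zero {z : (maxNilIdealC F).toIdeal}
    (hz : Polynomial.aeval (((z : CBall F)) : CompletedAlgClosure F) ((ltPoly F π).map (algebraMap 𝒪[F] F)) = 0) :
    ∃ c : 𝓀[F], (z : CBall F) = unitBallToCBall (ltField π 0) (ltDivPt hπ 0 c : unitBall (ltField π 0)) := by
  classical
  letI : Fintype 𝓀[F] := Fintype.ofFinite _
  -- `z` is algebraic: `z = ι(y)` for some `y ∈ K_π^1`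
  have hz1 : Polynomial.aeval (((z : CBall F)) : CompletedAlgClosure F)
      ((ltPolyIter F π (0 + 1)).map (algebraMap 𝒪[F] F)) = 0 := by
    rw [zero_add, ltPolyIter_succ, ltPolyIter_zero, Polynomial.comp_X]
    exact hz
  obtain ⟨y, hy⟩ := exists_algClosureToC_eq_of_aeval_eq_zero hπ 0 hz1
  -- `y ∈ 𝔪_{K_π^1}`: `F̄ → ℂ_F` is an isometry on `K_π^1`
  have hynorm : ‖y‖ = ‖(((z : CBall F)) : CompletedAlgClosure F)‖ := by
    rw [← hy, norm_algClosureToC_coe]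
  have hyO : y ∈ unitBall (ltField π 0) := by
    rw [mem_unitBall_iff, hynorm]
    exact (mem_unitBall_iff _).mp (z : CBall F).2
  -- `y` is a root of `f` in `K_π^1`
  set g : ltField π 0 →+* CompletedAlgClosure F :=
    (algClosureToC F).comp (algebraMap (ltField π 0) (AlgebraicClosure F)) with hgdef
  have hg : ∀ x : ltField π 0, g x = algClosureToC F (x : AlgebraicClosure F) := fun _ => rfl
  have hgF : g.comp (algebraMap F (ltField π 0)) = algebraMap F (CompletedAlgClosure F) := by
    ext a
    rw [RingHom.comp_apply, hg]
    exact algClosureToC_algebraMap a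
  have hyroot : Polynomial.aeval y ((ltPoly F π).map (algebraMap 𝒪[F] F)) = 0 := by
    apply g.injective
    rw [map_zero, Polynomial.aeval_def, Polynomial.hom_eval₂, hgF, ← Polynomial.aeval_def, hg, hy]
    exact hz
  -- hence of `∏_c (X − ω_c)` in the domain `𝒪_{K_π^1}`
  have hyroot' : Polynomial.aeval (⟨y, hyO⟩ : unitBall (ltField π 0)) (ltPoly F π) = 0 := by
    apply Subtype.ext
    rw [coe_aeval_integer]
    exact hyroot
  have hprod : (∏ c : 𝓀[F], ((⟨y, hyO⟩ : unitBall (ltField π 0)) -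
      ((ltDivPt hπ 0 c : (maxNilIdeal F (ltField π 0)).toIdeal) : unitBall (ltField π 0)))) = 0 := by
    have h := congrArg (Polynomial.eval (⟨y, hyO⟩ : unitBall (ltField π 0))) (map_ltPoly_eq_prod hπ 0)
    rw [Polynomial.eval_map_algebraMap, hyroot', Polynomial.eval_prod] at h
    simp only [Polynomial.eval_sub, Polynomial.eval_X, Polynomial.eval_C] at h
    exact h.symm
  obtain ⟨c, -, hc⟩ := Finset.prod_eq_zero_iff.mp hprod
  refine ⟨c, ?_⟩
  have hyc : (⟨y, hyO⟩ : unitBall (ltField π 0)) =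
      ((ltDivPt hπ 0 c : (maxNilIdeal F (ltField π 0)).toIdeal) : unitBall (ltField π 0)) := sub_eq_zero.mp hc
  apply Subtype.ext
  rw [coe_unitBallToCBall, ← hyc]
  exact hy.symm

/-- The same, pointed in `𝔪_ℂ`: `z = ω_c` as points of `maxNilIdealC F` — the hypothesis `hΘω` of
`exists_rootsOfUnity_enum_of_torsion_transport` for `Θ z := ϑ(z)` once `f'(ϑ(z)) = 0` is known
(torsion transport). [cite: CasselsFrohlichANT1967, Ch. VI §3.6 Prop. 6 (a)] -/
theorem exists_eq_ltDivPt_point_of_aeval_ltPoly_eq_zero {z : (maxNilIdealC F).toIdeal}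
    (hz : Polynomial.aeval (((z : CBall F)) : CompletedAlgClosure F) ((ltPoly F π).map (algebraMap 𝒪[F] F)) = 0) :
    ∃ c : 𝓀[F], z = ⟨unitBallToCBall (ltField π 0) (ltDivPt hπ 0 c : unitBall (ltField π 0)),
      unitBallToCBall_mem (ltField π 0) (ltDivPt hπ 0 c).2⟩ := by
  obtain ⟨c, hc⟩ := exists_eq_ltDivPt_toCBall_of_aeval_ltPoly_eq_zero hπ hz
  exact ⟨c, Subtype.ext hc⟩

end DivisionPoints

end Literature.NumberTheory.GaloisRepresentations

end
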